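import Summits.QuantumFields.BalabanUV.Beta.CapAnchorBudget
import Literature.MathematicalPhysics.QuantumFieldTheory.Balaban1983to89.Beta.AliasingTailLattice

/-!
# Beta / CapLatticeBudget — BINDER-OWNERS row CAP-k, item (b): the arithmetic BUDGET of the lattice-rule (code16) anchor and the `N = 2` NEGATIVE
# (β sub-cell, DEDICATED row BETA-an5, lineage `b2b-balaban-beta-an5` = OWNER of row CAP-k; gen 20, prover seat; sibling of `CapAnchorBudget`)

HONEST FRAMING (page 1 of everything the β sub-cell writes): discharging `BetaPertH` makes Bałaban's UV stability UNCONDITIONAL — a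
real constructive-QFT result; it is NOT the continuum limit and NOT the Clay problem.  HONEST DEPENDENCY (cell reorg 2026-08-19, verbatim):
«continuum YM on T⁴ ⇐ BetaPertH ∧ nine spine estimates (0/9 proved); BetaPertH ⇐ (D1) ∧ (D4) ∧ CAP+tail; G-an2-4 gates asym, D1 and NE2/3/4.»
THIS MODULE INSTANTIATES NO BINDER.  It proves, about the anchor rows `CapRowsLattice.rowsOfCode16(E)` (the code16 shell of row CAP-k item (b)):

 §1 WORKED SIZES (closed rational bounds the kernel evaluates, pattern of `CapAnchorBudget` §3): the sampling mean is bounded by the strip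
    bound `M`; `aliasRatioL1 (9/10) N ≤ 1/6, 1/36, 1/90, 1/3250` (`N = 2, 4, 5, 9`; `N = 8, 10, 12` are `CapAnchorBudget`'s);
    `codeTheta (aliasRatioL1 (9/10) N) ≤ 3/100 ∕ 43/2000000 ∕ 11/20000000 ∕ 13/10¹² ∕ 4/10¹³ ∕ 1/10¹⁴ ∕ 1/10¹⁷` (`N = 2 ∕ 4 ∕ 5 ∕ 8 ∕ 9 ∕ 10 ∕ 12`);
    the budget inequality `tail_le_budget_code16` and the ADMISSIBLE certified sup bounds for a tail budget `1/4`: `M ≤ 11627` (N = 4, the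
    4 096 nodes of the period-16 grid), `M ≤ 454545` (N = 5, 10⁴ nodes, period 20), `M ≤ 1.9·10¹⁰` (N = 8, 65 536 nodes, period 32),
    `M ≤ 6.25·10¹¹` (N = 9, 104 976 nodes), `M ≤ 2.5·10¹³` (N = 10, 160 000 nodes), `M ≤ 2.5·10¹⁶` (N = 12, 331 776 nodes).  For comparison
    (cell file BETA/CAP-KERNEL.md §4.10 (iii), float-truth SIZES there, NOT certified and NOT asserted here): the tree-gauge norm-route master
    bound for the strip constant is of size 2·10¹⁰–7·10¹⁰, which the CUBIC grid tolerates only at period 36–40 (1.7–2.6·10⁶ nodes; the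
    `ℓ¹` cubic sizes are `CapAnchorBudget` §3 and `Certified`); the code16 rule tolerates it at `N = 9–10` (1.0–1.6·10⁵ nodes).
 §2 THE `N = 2` NEGATIVE (the period-8 code16 node set, 256 nodes — the size of the engines' existing code16 waves): for EVERY strip half-width
    `0 < κ ≤ 1` the code16 tail constant is at least `3/250` (`codeTheta (aliasRatioL1 κ 2) ≥ 3/250`), so the certified `lo` of
    `rowsOfCode16(E)` at `N = 2` obeys `lo ≤ t − r − (3/250)·M`, and a POSITIVE `lo` forces `M < (250/3)(t − r)` on the (Z2) certification —
    a statement about the export's hypotheses; nothing about Bałaban's coefficients is asserted.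

 §3 (v1.1, APPEND-ONLY) THE PARAMETRIC BUDGET: the closed form `codeTheta q = q⁴(36 + 48q² + 88q⁴ + 48q⁶ + 36q⁸)/(1 − q⁴)⁴`,
    `codeTheta q ≤ 38·q⁴` on `[0, 1/6]`, `budget_code16_param` for ANY `(κ, N)`, worked rows `N = 11, 13` (`κ = 9/10`) and `κ′ = 3/5, N = 16`.

ABSOLUTE RULE (cell charter, verbatim): "No internally-minted statement may enter as a cited fact. Every hypothesis is either
kernel-proved in this package or a verbatim quotation of a PUBLISHED theorem with page reference. The manuscript(s) under audit are
NOT citable for their own disputed steps — they are the thing under adjudication; programme-internal (2001/route/tribunal) claims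
are never citable."  Nothing is cited here; every statement is arithmetic or a consequence of the tree's own definitions. [folklore]
The numerals were fixed by two stdlib engines before filing (exact `fractions` ∕ 60-digit `decimal`, `census/code16_budget.py` of the
gen-20 seat folder: E1 ≡ E2; every kernel target verified exactly) and are re-proved here by `norm_num`.
-/

namespace Summit.QuantumFields.BalabanUV.Beta.CapLatticeBudget

open Literature.MathematicalPhysics.QuantumFieldTheory.Balaban1983to89
open Literature.MathematicalPhysics.QuantumFieldTheory.Balaban1983to89.Beta
open B4ContourShift (latticeKernel StripRegular)
open B4TorusKernel (descend gridPt)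
open Beta.AliasingTailL1 (StripRegularC aliasRatioL1 aliasRatioL1_pos aliasRatioL1_lt_one)
open Beta.AliasingTailLattice (codeTheta codePoly resSeries codeTheta_mono)
open Beta.Certified (exp_neg_le_inv_sum)
open Summit.QuantumFields.BalabanUV.Beta.CapAnchorBudget (norm_descend_le stripBound_nonneg aliasRatioL1_two_ge
  aliasRatioL1_nine_tenths_eight_le aliasRatioL1_nine_tenths_ten_le aliasRatioL1_nine_tenths_twelve_le)

/-! ## §1 The code16 budget: worked sizes the kernel evaluates -/

section Budget

variable {d P : ℕ}

/-- **The sampling mean is bounded by the strip bound**: `‖|S|⁻¹ Σ_{w ∈ S} G(2π rep(w/P))‖ ≤ M` for any non-empty `S` (so an engine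
centre `t` obeys `t ≤ M + r` by `CapAnchorBudget.le_norm_add_of_ball`). [folklore] -/
theorem norm_samplingMean_le {G : (Fin (d + 1) → ℂ) → ℂ} {κ M : ℝ} (h : StripRegular G κ M) (hκ : 0 ≤ κ)
    (S : Finset (Fin (d + 1) → Fin P)) (hS : S.Nonempty) :
    ‖(S.card : ℂ)⁻¹ * (∑ w ∈ S, descend G (gridPt P w))‖ ≤ M := by
  have hc : (0 : ℝ) < (S.card : ℝ) := by exact_mod_cast Finset.card_pos.mpr hS
  have hsum : ‖∑ w ∈ S, descend G (gridPt P w)‖ ≤ (S.card : ℝ) * M := by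
    calc ‖∑ w ∈ S, descend G (gridPt P w)‖ ≤ ∑ w ∈ S, ‖descend G (gridPt P w)‖ := norm_sum_le _ _
      _ ≤ ∑ _w ∈ S, M := Finset.sum_le_sum fun w _ => norm_descend_le h hκ _
      _ = (S.card : ℝ) * M := by rw [Finset.sum_const, nsmul_eq_mul]
  rw [norm_mul, norm_inv, Complex.norm_natCast]
  calc ((S.card : ℝ))⁻¹ * ‖∑ w ∈ S, descend G (gridPt P w)‖ ≤ ((S.card : ℝ))⁻¹ * ((S.card : ℝ) * M) :=
        mul_le_mul_of_nonneg_left hsum (by positivity)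
    _ = M := by field_simp

/-- monotonicity of the code16 tail in the alias ratio, in the form used below: a rational `q` with `aliasRatioL1 κ N ≤ q < 1` gives
`codeTheta (aliasRatioL1 κ N) ≤ codeTheta q`. [folklore] -/
theorem codeTheta_le_of_ratio_le {κ q : ℝ} {N : ℕ} (hq : aliasRatioL1 κ N ≤ q) (hq1 : q < 1) :
    codeTheta (aliasRatioL1 κ N) ≤ codeTheta q :=
  codeTheta_mono (aliasRatioL1_pos κ N).le hq hq1

/-- WORKED SIZE `N = 2` (`κ = 9/10`): `e^{−9/5} ≤ 1/6`. [folklore] -/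
theorem aliasRatioL1_nine_tenths_two_le : aliasRatioL1 (9 / 10) 2 ≤ 1 / 6 := by
  unfold aliasRatioL1
  have he : Real.exp (-((9 : ℝ) / 10 * (2 : ℕ))) ≤ (∑ i ∈ Finset.range 20, ((9 : ℝ) / 5) ^ i / (i.factorial : ℝ))⁻¹ := by
    rw [show ((9 : ℝ) / 10 * (2 : ℕ)) = 9 / 5 by push_cast; norm_num]
    exact exp_neg_le_inv_sum (by norm_num) (by norm_num)
  refine he.trans ?_
  simp only [Finset.sum_range_succ, Finset.sum_range_zero, Nat.factorial]
  norm_num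

/-- WORKED SIZE `N = 4` (`κ = 9/10`): `e^{−18/5} ≤ 1/36`. [folklore] -/
theorem aliasRatioL1_nine_tenths_four_le : aliasRatioL1 (9 / 10) 4 ≤ 1 / 36 := by
  unfold aliasRatioL1
  have he : Real.exp (-((9 : ℝ) / 10 * (4 : ℕ))) ≤ (∑ i ∈ Finset.range 30, ((18 : ℝ) / 5) ^ i / (i.factorial : ℝ))⁻¹ := by
    rw [show ((9 : ℝ) / 10 * (4 : ℕ)) = 18 / 5 by push_cast; norm_num]
    exact exp_neg_le_inv_sum (by norm_num) (by norm_num)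
  refine he.trans ?_
  simp only [Finset.sum_range_succ, Finset.sum_range_zero, Nat.factorial]
  norm_num

/-- WORKED SIZE `N = 5` (`κ = 9/10`): `e^{−9/2} ≤ 1/90`. [folklore] -/
theorem aliasRatioL1_nine_tenths_five_le : aliasRatioL1 (9 / 10) 5 ≤ 1 / 90 := by
  unfold aliasRatioL1
  have he : Real.exp (-((9 : ℝ) / 10 * (5 : ℕ))) ≤ (∑ i ∈ Finset.range 34, ((9 : ℝ) / 2) ^ i / (i.factorial : ℝ))⁻¹ := by
    rw [show ((9 : ℝ) / 10 * (5 : ℕ)) = 9 / 2 by push_cast; norm_num]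
    exact exp_neg_le_inv_sum (by norm_num) (by norm_num)
  refine he.trans ?_
  simp only [Finset.sum_range_succ, Finset.sum_range_zero, Nat.factorial]
  norm_num

/-- THE CODE16 TAIL AT `N = 2` (`κ = 9/10`; the period-8 grid, 256 nodes): `≤ 3/100` (true value ≈ 2.80e-2). [folklore] -/
theorem codeTheta_nine_tenths_two_le : codeTheta (aliasRatioL1 (9 / 10) 2) ≤ 3 / 100 :=
  (codeTheta_le_of_ratio_le aliasRatioL1_nine_tenths_two_le (by norm_num)).trans
    (by norm_num [codeTheta, codePoly, resSeries])

/-- THE CODE16 TAIL AT `N = 4` (`κ = 9/10`; period 16, 4 096 nodes): `≤ 43/2000000` (= 2.15e-5; true value ≈ 2.01e-5). [folklore] -/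
theorem codeTheta_nine_tenths_four_le : codeTheta (aliasRatioL1 (9 / 10) 4) ≤ 43 / 2000000 :=
  (codeTheta_le_of_ratio_le aliasRatioL1_nine_tenths_four_le (by norm_num)).trans
    (by norm_num [codeTheta, codePoly, resSeries])

/-- THE CODE16 TAIL AT `N = 5` (`κ = 9/10`; period 20, 10 000 nodes): `≤ 11/20000000` (= 5.5e-7; true value ≈ 5.48e-7). [folklore] -/
theorem codeTheta_nine_tenths_five_le : codeTheta (aliasRatioL1 (9 / 10) 5) ≤ 11 / 20000000 :=
  (codeTheta_le_of_ratio_le aliasRatioL1_nine_tenths_five_le (by norm_num)).trans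
    (by norm_num [codeTheta, codePoly, resSeries])

/-- THE CODE16 TAIL AT `N = 8` (`κ = 9/10`; period 32, 65 536 nodes): `≤ 13/10¹²` (true value ≈ 1.12e-11). [folklore] -/
theorem codeTheta_nine_tenths_eight_le : codeTheta (aliasRatioL1 (9 / 10) 8) ≤ 13 / 1000000000000 :=
  (codeTheta_le_of_ratio_le aliasRatioL1_nine_tenths_eight_le (by norm_num)).trans
    (by norm_num [codeTheta, codePoly, resSeries])

/-- WORKED SIZE `N = 9` (`κ = 9/10`): `e^{−81/10} ≤ 1/3250`. [folklore] -/
theorem aliasRatioL1_nine_tenths_nine_le : aliasRatioL1 (9 / 10) 9 ≤ 1 / 3250 := by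
  unfold aliasRatioL1
  have he : Real.exp (-((9 : ℝ) / 10 * (9 : ℕ))) ≤ (∑ i ∈ Finset.range 40, ((81 : ℝ) / 10) ^ i / (i.factorial : ℝ))⁻¹ := by
    rw [show ((9 : ℝ) / 10 * (9 : ℕ)) = 81 / 10 by push_cast; norm_num]
    exact exp_neg_le_inv_sum (by norm_num) (by norm_num)
  refine he.trans ?_
  simp only [Finset.sum_range_succ, Finset.sum_range_zero, Nat.factorial]
  norm_num

/-- THE CODE16 TAIL AT `N = 9` (`κ = 9/10`; period 36, 104 976 nodes): `≤ 4/10¹³` (true value ≈ 3.06e-13). [folklore] -/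
theorem codeTheta_nine_tenths_nine_le : codeTheta (aliasRatioL1 (9 / 10) 9) ≤ 4 / 10000000000000 :=
  (codeTheta_le_of_ratio_le aliasRatioL1_nine_tenths_nine_le (by norm_num)).trans
    (by norm_num [codeTheta, codePoly, resSeries])

/-- THE CODE16 TAIL AT `N = 10` (`κ = 9/10`; period 40, 160 000 nodes): `≤ 1/10¹⁴` (true value ≈ 8.35e-15;
`aliasRatioL1 (9/10) 10 ≤ 1/8000` is `CapAnchorBudget.aliasRatioL1_nine_tenths_ten_le`). [folklore] -/
theorem codeTheta_nine_tenths_ten_le : codeTheta (aliasRatioL1 (9 / 10) 10) ≤ 1 / 100000000000000 :=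
  (codeTheta_le_of_ratio_le aliasRatioL1_nine_tenths_ten_le (by norm_num)).trans
    (by norm_num [codeTheta, codePoly, resSeries])

/-- THE CODE16 TAIL AT `N = 12` (`κ = 9/10`; period 48, 331 776 nodes): `≤ 1/10¹⁷` (true value ≈ 6.2e-18;
`aliasRatioL1 (9/10) 12 ≤ 1/48000` is `CapAnchorBudget.aliasRatioL1_nine_tenths_twelve_le`). [folklore] -/
theorem codeTheta_nine_tenths_twelve_le : codeTheta (aliasRatioL1 (9 / 10) 12) ≤ 1 / 100000000000000000 :=
  (codeTheta_le_of_ratio_le aliasRatioL1_nine_tenths_twelve_le (by norm_num)).trans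
    (by norm_num [codeTheta, codePoly, resSeries])

/-- THE BUDGET INEQUALITY (code16 form of `CapAnchorBudget.tail_le_budget`): if `codeTheta (aliasRatioL1 κ N) ≤ q` (`q > 0`) and the
certified sup bound satisfies `M ≤ τ / q`, then `M·codeTheta (aliasRatioL1 κ N) ≤ τ` — so `A := τ`, `lo := t − r − τ` are admissible in
`CapRowsLattice.rowsOfCode16(E)`. [folklore] -/
theorem tail_le_budget_code16 {κ M q τ : ℝ} {N : ℕ} (hM0 : 0 ≤ M) (hq : codeTheta (aliasRatioL1 κ N) ≤ q) (hq0 : 0 < q)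
    (hM : M ≤ τ / q) : M * codeTheta (aliasRatioL1 κ N) ≤ τ := by
  have h1 : M * codeTheta (aliasRatioL1 κ N) ≤ M * q := mul_le_mul_of_nonneg_left hq hM0
  have h2 : M * q ≤ τ := by rwa [le_div_iff₀ hq0] at hM
  linarith

/-- ADMISSIBLE certified sup bound at `N = 4` for a tail budget `1/4`: every `0 ≤ M ≤ 11627`. [folklore] -/
theorem budget_code16_four {M : ℝ} (hM0 : 0 ≤ M) (hM : M ≤ 11627) : M * codeTheta (aliasRatioL1 (9 / 10) 4) ≤ 1 / 4 :=
  tail_le_budget_code16 hM0 codeTheta_nine_tenths_four_le (by norm_num) (hM.trans (by norm_num))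

/-- ADMISSIBLE certified sup bound at `N = 5` for a tail budget `1/4`: every `0 ≤ M ≤ 454545`. [folklore] -/
theorem budget_code16_five {M : ℝ} (hM0 : 0 ≤ M) (hM : M ≤ 454545) : M * codeTheta (aliasRatioL1 (9 / 10) 5) ≤ 1 / 4 :=
  tail_le_budget_code16 hM0 codeTheta_nine_tenths_five_le (by norm_num) (hM.trans (by norm_num))

/-- ADMISSIBLE certified sup bound at `N = 8` for a tail budget `1/4`: every `0 ≤ M ≤ 19230769230` (≈ 1.9·10¹⁰). [folklore] -/
theorem budget_code16_eight {M : ℝ} (hM0 : 0 ≤ M) (hM : M ≤ 19230769230) :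
    M * codeTheta (aliasRatioL1 (9 / 10) 8) ≤ 1 / 4 :=
  tail_le_budget_code16 hM0 codeTheta_nine_tenths_eight_le (by norm_num) (hM.trans (by norm_num))

/-- ADMISSIBLE certified sup bound at `N = 9` for a tail budget `1/4`: every `0 ≤ M ≤ 625000000000` (6.25·10¹¹). [folklore] -/
theorem budget_code16_nine {M : ℝ} (hM0 : 0 ≤ M) (hM : M ≤ 625000000000) :
    M * codeTheta (aliasRatioL1 (9 / 10) 9) ≤ 1 / 4 :=
  tail_le_budget_code16 hM0 codeTheta_nine_tenths_nine_le (by norm_num) (hM.trans (by norm_num))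

/-- ADMISSIBLE certified sup bound at `N = 10` for a tail budget `1/4`: every `0 ≤ M ≤ 25000000000000` (2.5·10¹³). [folklore] -/
theorem budget_code16_ten {M : ℝ} (hM0 : 0 ≤ M) (hM : M ≤ 25000000000000) :
    M * codeTheta (aliasRatioL1 (9 / 10) 10) ≤ 1 / 4 :=
  tail_le_budget_code16 hM0 codeTheta_nine_tenths_ten_le (by norm_num) (hM.trans (by norm_num))

/-- ADMISSIBLE certified sup bound at `N = 12` for a tail budget `1/4`: every `0 ≤ M ≤ 25000000000000000` (2.5·10¹⁶). [folklore] -/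
theorem budget_code16_twelve {M : ℝ} (hM0 : 0 ≤ M) (hM : M ≤ 25000000000000000) :
    M * codeTheta (aliasRatioL1 (9 / 10) 12) ≤ 1 / 4 :=
  tail_le_budget_code16 hM0 codeTheta_nine_tenths_twelve_le (by norm_num) (hM.trans (by norm_num))

end Budget

/-! ## §2 The `N = 2` negative: the period-8 code16 node set costs at least 1.2 % of `M` -/

section NegativeTwo

/-- For EVERY strip half-width `0 < κ ≤ 1` the code16 tail constant at `N = 2` is at least `3/250`
(`aliasRatioL1 κ 2 = e^{−2κ} ≥ e^{−2} ≥ 0.135` and `codeTheta 0.135 ≥ 3/250` by monotonicity). [folklore] -/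
theorem codeTheta_two_ge {κ : ℝ} (hκ0 : 0 < κ) (hκ1 : κ ≤ 1) : (3 / 250 : ℝ) ≤ codeTheta (aliasRatioL1 κ 2) := by
  have hρ : (0.135 : ℝ) ≤ aliasRatioL1 κ 2 := aliasRatioL1_two_ge hκ1
  have hρ1 : aliasRatioL1 κ 2 < 1 := aliasRatioL1_lt_one hκ0 (by norm_num)
  have hmono := codeTheta_mono (by norm_num : (0 : ℝ) ≤ 0.135) hρ hρ1
  have hnum : (3 / 250 : ℝ) ≤ codeTheta 0.135 := by norm_num [codeTheta, codePoly, resSeries]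
  exact hnum.trans hmono

/-- **THE `N = 2` NEGATIVE.**  Under the tail hypothesis of `CapRowsLattice.rowsOfCode16(E)` at `N = 2` (`M·codeTheta (aliasRatioL1 κ 2) ≤ A`) and the
comparison `lo ≤ t − r − A`, for every `0 < κ ≤ 1`: `lo ≤ t − r − (3/250)·M`. [folklore] -/
theorem lo_le_of_code16_two {G : (Fin 4 → ℂ) → ℂ} {κ M : ℝ} (h : StripRegularC G κ M) (hκ0 : 0 < κ) (hκ1 : κ ≤ 1)
    {t r A : ℝ} (hA : M * codeTheta (aliasRatioL1 κ 2) ≤ A) {lo : ℚ} (hlo : ((lo : ℚ) : ℝ) ≤ t - r - A) :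
    ((lo : ℚ) : ℝ) ≤ t - r - 3 / 250 * M := by
  have hM : 0 ≤ M := stripBound_nonneg (h.toStripRegular hκ0.le) hκ0.le
  have hθ := codeTheta_two_ge hκ0 hκ1
  have h1 : 3 / 250 * M ≤ A := le_trans (by nlinarith) hA
  linarith

/-- hence a POSITIVE certified `lo` through the `N = 2` code16 export forces `M < (250/3)(t − r)` on the (Z2) certification. [folklore] -/
theorem stripBound_lt_of_code16_two_pos {G : (Fin 4 → ℂ) → ℂ} {κ M : ℝ} (h : StripRegularC G κ M) (hκ0 : 0 < κ)
    (hκ1 : κ ≤ 1) {t r A : ℝ} (hA : M * codeTheta (aliasRatioL1 κ 2) ≤ A) {lo : ℚ} (hlo : ((lo : ℚ) : ℝ) ≤ t - r - A)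
    (hpos : 0 < lo) : M < 250 / 3 * (t - r) := by
  have h1 := lo_le_of_code16_two h hκ0 hκ1 hA hlo
  have h2 : (0 : ℝ) < ((lo : ℚ) : ℝ) := by exact_mod_cast hpos
  linarith

end NegativeTwo


/-! ## §3 (v1.1, APPEND-ONLY) The PARAMETRIC code16 budget: closed form, `codeTheta q ≤ 38·q⁴`, any `(κ, N)`

The table of §1 fixes `κ = 9/10` and seven periods.  The decision on the (S4) lane may land elsewhere (cap3-g8 XREAD l.3360 INFO I1:
the norm chain for the JET functional is larger — `N ≈ 11–13` at `κ = 9/10`, or a Cauchy-shrunk half-width `κ′ < 9/10`).  This section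
makes the budget parametric: the EXACT closed form `codeTheta q = q⁴(36 + 48q² + 88q⁴ + 48q⁶ + 36q⁸)/(1 − q⁴)⁴` (cap3's
`36ρ⁴ + 48ρ⁶ + O(ρ⁸)` made exact), the clean majorant `codeTheta q ≤ 38·q⁴` on `0 ≤ q ≤ 1/6`, hence for ANY `κ`, `N` and any rational
`q` with `e^{−κN} ≤ q ≤ 1/6` (`q` from `Certified.exp_neg_le_inv_sum`, one `norm_num` line): `M·codeTheta (aliasRatioL1 κ N) ≤ 38·q⁴·M`,
and the budget `budget_code16_param`.  Worked: `N = 11` (`M ≤ 1.03·10¹⁵`), `N = 13` (`M ≤ 1.36·10¹⁸`) at `κ = 9/10`; `κ′ = 3/5, N = 16`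
(`M ≤ 3.07·10¹⁴`).  Numerals fixed by two stdlib engines (`census/code16_param.py`: closed form ≡ `codeTheta` exactly at five rationals;
ratio `codeTheta q / q⁴` increasing on `(0, 1/6]`, `= 37.518` at `1/6`). [folklore] -/

section Parametric

/-- THE CLOSED FORM of the code16 dual-shell sum: `codeTheta q = q⁴(36 + 48q² + 88q⁴ + 48q⁶ + 36q⁸)/(1 − q⁴)⁴` (`q⁴ ≠ 1`). [folklore] -/
theorem codeTheta_closed_form {q : ℝ} (hq : 1 - q ^ 4 ≠ 0) :
    codeTheta q = q ^ 4 * (36 + 48 * q ^ 2 + 88 * q ^ 4 + 48 * q ^ 6 + 36 * q ^ 8) / (1 - q ^ 4) ^ 4 := by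
  unfold codeTheta codePoly resSeries
  simp only [pow_zero, Nat.sub_zero, pow_one]
  norm_num
  field_simp
  ring

/-- THE PARAMETRIC MAJORANT: `codeTheta q ≤ 38·q⁴` for `0 ≤ q ≤ 1/6` (the ratio is `36` at `0`, `37.52` at `1/6`). [folklore] -/
theorem codeTheta_le_pow_four {q : ℝ} (h0 : 0 ≤ q) (h6 : q ≤ 1 / 6) : codeTheta q ≤ 38 * q ^ 4 := by
  have hq2 : q ^ 2 ≤ 1 / 36 := by nlinarith
  have hu0 : 0 ≤ q ^ 2 := by positivity
  have hq4 : q ^ 4 ≤ 1 / 1296 := by nlinarith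
  have hq40 : 0 ≤ q ^ 4 := by positivity
  have hD : 0 < 1 - q ^ 4 := by linarith
  have hD4 : 0 < (1 - q ^ 4) ^ 4 := by positivity
  rw [codeTheta_closed_form hD.ne', div_le_iff₀ hD4]
  -- reduce to `R(q) ≤ 38 (1 − q⁴)⁴` times `q⁴ ≥ 0`, with `u = q²`
  have hR : 36 + 48 * q ^ 2 + 88 * q ^ 4 + 48 * q ^ 6 + 36 * q ^ 8 ≤ 38 * (1 - q ^ 4) ^ 4 := by
    have h6' : q ^ 6 ≤ 1 / 36 * q ^ 4 := by nlinarith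
    have h8' : q ^ 8 ≤ 1 / 1296 * q ^ 4 := by nlinarith
    have hlow : 38 * (1 - 4 * q ^ 4) ≤ 38 * (1 - q ^ 4) ^ 4 := by nlinarith
    nlinarith
  calc q ^ 4 * (36 + 48 * q ^ 2 + 88 * q ^ 4 + 48 * q ^ 6 + 36 * q ^ 8)
      ≤ q ^ 4 * (38 * (1 - q ^ 4) ^ 4) := mul_le_mul_of_nonneg_left hR hq40
    _ = 38 * q ^ 4 * (1 - q ^ 4) ^ 4 := by ring

/-- the majorant along the alias ratio: `e^{−κN} ≤ q ≤ 1/6` ⇒ `codeTheta (aliasRatioL1 κ N) ≤ 38·q⁴`. [folklore] -/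
theorem codeTheta_aliasRatio_le_pow_four {κ q : ℝ} {N : ℕ} (hq : aliasRatioL1 κ N ≤ q) (h6 : q ≤ 1 / 6) :
    codeTheta (aliasRatioL1 κ N) ≤ 38 * q ^ 4 :=
  (codeTheta_le_of_ratio_le hq (by linarith)).trans (codeTheta_le_pow_four ((aliasRatioL1_pos κ N).le.trans hq) h6)

/-- **THE PARAMETRIC BUDGET** (any `κ`, any period): `0 ≤ M`, `e^{−κN} ≤ q ≤ 1/6`, `38·q⁴·M ≤ τ` ⇒ `M·codeTheta (aliasRatioL1 κ N) ≤ τ` — so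
`A := τ`, `lo := t − r − τ` are admissible in `CapRowsLattice.rowsOfCode16(E)` at that `(κ, N)`. [folklore] -/
theorem budget_code16_param {κ M q τ : ℝ} {N : ℕ} (hM0 : 0 ≤ M) (hq : aliasRatioL1 κ N ≤ q) (h6 : q ≤ 1 / 6)
    (hM : 38 * q ^ 4 * M ≤ τ) : M * codeTheta (aliasRatioL1 κ N) ≤ τ := by
  have h1 : M * codeTheta (aliasRatioL1 κ N) ≤ M * (38 * q ^ 4) :=
    mul_le_mul_of_nonneg_left (codeTheta_aliasRatio_le_pow_four hq h6) hM0
  linarith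

/-- the alias ratio against a truncated exponential series: `e^{−κN} ≤ (Σ_{i<n} (κN)^i/i!)⁻¹` (`κ ≥ 0`, `n ≥ 1`) — the consumer's `q`.
[folklore] -/
theorem aliasRatioL1_le_inv_partialSum {κ : ℝ} (hκ : 0 ≤ κ) (N : ℕ) {n : ℕ} (hn : 1 ≤ n) :
    aliasRatioL1 κ N ≤ (∑ i ∈ Finset.range n, (κ * N) ^ i / (i.factorial : ℝ))⁻¹ := by
  unfold aliasRatioL1
  exact exp_neg_le_inv_sum (by positivity) hn

/-- WORKED ROW `N = 11` (`κ = 9/10`; period 44, 234 256 nodes): `e^{−99/10} ≤ 1/19900`. [folklore] -/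
theorem aliasRatioL1_nine_tenths_eleven_le : aliasRatioL1 (9 / 10) 11 ≤ 1 / 19900 := by
  refine (aliasRatioL1_le_inv_partialSum (by norm_num) 11 (by norm_num : 1 ≤ 45)).trans ?_
  rw [show ((9 : ℝ) / 10 * (11 : ℕ)) = 99 / 10 by push_cast; norm_num]
  simp only [Finset.sum_range_succ, Finset.sum_range_zero, Nat.factorial]
  norm_num

/-- ADMISSIBLE certified sup bound at `N = 11` for a tail budget `1/4`: every `0 ≤ M ≤ 10¹⁵` (true admissible ≈ 1.03·10¹⁵). [folklore] -/
theorem budget_code16_eleven {M : ℝ} (hM0 : 0 ≤ M) (hM : M ≤ 1000000000000000) :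
    M * codeTheta (aliasRatioL1 (9 / 10) 11) ≤ 1 / 4 :=
  budget_code16_param hM0 aliasRatioL1_nine_tenths_eleven_le (by norm_num) (by nlinarith)

/-- WORKED ROW `N = 13` (`κ = 9/10`; period 52, 456 976 nodes): `e^{−117/10} ≤ 1/120000`. [folklore] -/
theorem aliasRatioL1_nine_tenths_thirteen_le : aliasRatioL1 (9 / 10) 13 ≤ 1 / 120000 := by
  refine (aliasRatioL1_le_inv_partialSum (by norm_num) 13 (by norm_num : 1 ≤ 50)).trans ?_
  rw [show ((9 : ℝ) / 10 * (13 : ℕ)) = 117 / 10 by push_cast; norm_num]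
  simp only [Finset.sum_range_succ, Finset.sum_range_zero, Nat.factorial]
  norm_num

/-- ADMISSIBLE certified sup bound at `N = 13` for a tail budget `1/4`: every `0 ≤ M ≤ 1.3·10¹⁸` (true admissible ≈ 1.36·10¹⁸). [folklore] -/
theorem budget_code16_thirteen {M : ℝ} (hM0 : 0 ≤ M) (hM : M ≤ 1300000000000000000) :
    M * codeTheta (aliasRatioL1 (9 / 10) 13) ≤ 1 / 4 :=
  budget_code16_param hM0 aliasRatioL1_nine_tenths_thirteen_le (by norm_num) (by nlinarith)

/-- WORKED ROW FOR A CAUCHY-SHRUNK STRIP `κ′ = 3/5`, `N = 16` (period 64, 1 048 576 nodes): `e^{−48/5} ≤ 1/14700`, admissible `M ≤ 3·10¹⁴`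
(true ≈ 3.07·10¹⁴). [folklore] -/
theorem budget_code16_three_fifths_sixteen {M : ℝ} (hM0 : 0 ≤ M) (hM : M ≤ 300000000000000) :
    M * codeTheta (aliasRatioL1 (3 / 5) 16) ≤ 1 / 4 := by
  have hq : aliasRatioL1 (3 / 5) 16 ≤ 1 / 14700 := by
    refine (aliasRatioL1_le_inv_partialSum (by norm_num) 16 (by norm_num : 1 ≤ 45)).trans ?_
    rw [show ((3 : ℝ) / 5 * (16 : ℕ)) = 48 / 5 by push_cast; norm_num]
    simp only [Finset.sum_range_succ, Finset.sum_range_zero, Nat.factorial]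
    norm_num
  exact budget_code16_param hM0 hq (by norm_num) (by nlinarith)

end Parametric

end Summit.QuantumFields.BalabanUV.Beta.CapLatticeBudget
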